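import Summits.Langlands.Langlands.Theorems.PhantomRMYoshidaResiduallyYoshidaLiftingEndoscopicReduction
import Summits.Langlands.Langlands.Theorems.PhantomRMYoshidaResiduallyYoshidaLiftingTraceLimitRemoval
import HarnessLib

/-!
# Route `PhantomRMYoshida`, crux `ResiduallyYoshidaLifting` (stmt-Langlands-13639), line
# `endoscopic-crossing-euler`: the open statements WITHOUT the endoscopic alternative (kernel-checked)

Continuation of `…EndoscopicReduction.lean` (lead c1-0) after the wave-1 stub-worker's ENDO-REMOVAL theorem
`stub_endoRemoval` (`…TraceLimitRemoval.lean` and its packages `…TraceLimit{,Endo,Pseudo,Unique,Idempotent,Residual,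
Complete,IntegralModel}.lean`, all `--supports stmt-Langlands-13639`): on an admissible residual fibre (`σ̄ ≇ σ̄'`
irreducible, a.e. Frobenius factorisation), an IRREDUCIBLE `ρ` which is to every precision `p⁻ⁿ` uniformly close in
trace to an automorphic-OR-ENDOSCOPIC approximant is to every precision close to an AUTOMORPHIC one (endoscopic
approximants to every precision would make `ρ ⊗ ℂ_p` reducible: Newton with loss, residual matching, rigidity of the
endoscopic components, Taylor's theorem over `ℂ_p`, Burnside).

Consequences recorded here (sorry-free):

* `ProAutStrict`, `ProAutOfShStrict`, `WeightTwoClassicalityAut` — line B's vocabulary and two open statements with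
  the `Endo` alternative DELETED (approximants automorphic);
* `proAutStrict_of_proAut` — under the fibre hypotheses, `ProAut S ρ → ProAutStrict S ρ` (endo-removal), hence
  `proAutOfShStrict_iff : ProAutOfShStrict ↔ ProAutOfSh` — **L1 may be stated without `Endo` at no cost**;
* `weightTwoClassicalityRes_of_aut : WeightTwoClassicalityAut → WeightTwoClassicalityRes` — **L2 may be weakened to
  automorphic approximants** (the registered Stub 4 follows from its `Aut`-only form), and
  `weightTwoClassicalityAut_of_phantomRMSector` (still `≤` target);
* `phantomRMSector_of_strict`, `residuallyYoshidaLifting_of_strict` — `ProAutOfSh → WeightTwoClassicalityAut →`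
  target / crux.

So the glued split recommended to the planner becomes: **L1 := `ProAutOfShStrict`** (every irreducible `Sh`-ρ on an
admissible fibre is, for some finite `S` and every `n`, uniformly `p⁻ⁿ`-close in trace to an AUTOMORPHIC `GSp`-valued
regular-Greenberg-ordinary representation unramified outside `S ∪ {p}` — Λ-adic `R^{ord}_𝔪 = 𝕋^{ord}_𝔪` at the
Yoshida `𝔪` read at the point of `ρ`; open) and **L2 := `WeightTwoClassicalityAut`** (classicality of `p`-adic limits
of automorphic ordinary traces in weight (2,2) at the Yoshida `𝔪`; `≤` target; in print only for residually
irreducible image, BCGP2021 Thm 8.4.1 / BCGP2025 §4.12).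

The registered sub-goal through which this file lands (`--supports stmt-Langlands-13639`) is
`stub_endoscopicResiduesStrict`.
-/

noncomputable section

-- `Summit.Langlands.Langlands.…` (summit = sub-problem name, D-0017 layout) trips `dupNamespace` on every decl.
set_option linter.dupNamespace false
set_option autoImplicit false

open IsDedekindDomain Filter Topology
open scoped NumberField
open Literature.NumberTheory.GaloisRepresentations Literature.NumberTheory.Automorphic
open Summit.Langlands.Langlands.Cruxes.ResiduallyYoshidaLifting.YoshidaDivisorSelmerCount
  (εb DetC Aut Sh isOdd_of_detC)

namespace Summit.Langlands.Langlands.Cruxes.ResiduallyYoshidaLifting.EndoscopicCrossingEuler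

/-! ## Vocabulary without the endoscopic alternative -/

section Vocabulary

variable (p : ℕ) [Fact p.Prime]

/-- `ProAutStrict hcpt ι S ρ` — ordinary pro-automorphy of tame level `S` with AUTOMORPHIC approximants: for every
`n`, `tr ρ` is uniformly `p⁻ⁿ`-close on `Γ_ℚ` to the trace of an automorphic `r'` with `OrdLevel S r'`
(`ProAut` with the `Endo` alternative deleted). [cite: BoxerEtAl2021, §7.3] -/
def ProAutStrict (hcpt : isCompact_glFiniteIntegralLevel 4 ℚ) (ι : PadicAlgCl p ≃+* ℂ)
    (S : Finset (HeightOneSpectrum (𝓞 ℚ))) (ρ : FramedGaloisRep ℚ (PadicAlgCl p) 4) : Prop :=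
  ∀ n : ℕ, ∃ r' : FramedGaloisRep ℚ (PadicAlgCl p) 4,
    Aut p hcpt ι r' ∧ OrdLevel p S r' ∧ ∀ g, ‖(r' g).val.trace - (ρ g).val.trace‖ ≤ (p : ℝ) ^ (-(n : ℤ))

end Vocabulary

/-- **L1 without `Endo` — `ProAutOfShStrict`**: on every admissible residual fibre every irreducible `Sh`-ρ is
ordinarily pro-automorphic of some tame level with AUTOMORPHIC approximants.  Equivalent to `ProAutOfSh`
(`proAutOfShStrict_iff`).  OPEN IN PRINT. -/
def ProAutOfShStrict : Prop :=
  ∀ (p : ℕ) [Fact p.Prime], p ≠ 2 → ∀ (k : Type) [Field k] [CharP k p] [IsAlgClosed k]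
    [TopologicalSpace k] [DiscreteTopology k] (red : Valued.integer (PadicAlgCl p) →+* k)
    (σ σ' : FramedGaloisRep ℚ k 2) (hcpt : isCompact_glFiniteIntegralLevel 4 ℚ) (ι : PadicAlgCl p ≃+* ℂ)
    (ρ : FramedGaloisRep ℚ (PadicAlgCl p) 4),
    σ.toGaloisRep.IsIrreducible → σ'.toGaloisRep.IsIrreducible → DetC p k σ σ' →
    (¬ ∃ g : GL (Fin 2) k, ∀ x, g * σ x * g⁻¹ = σ' x) →
    ρ.toGaloisRep.IsIrreducible → Sh p k red σ σ' ρ →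
    ∃ S : Finset (HeightOneSpectrum (𝓞 ℚ)), ProAutStrict p hcpt ι S ρ

/-- **L2 with automorphic approximants — `WeightTwoClassicalityAut`**: the registered Stub 4
`WeightTwoClassicalityRes` with the `Endo` alternative deleted from its limit hypothesis (same binders and residual
hypotheses): an irreducible, symplectic-`ε⁻¹`, Greenberg-`(0,0,1,1)`, `p`-distinguished, residually-`σ̄ ⊕ σ̄'` `ρ`
whose trace is to every precision uniformly close to the trace of an AUTOMORPHIC `GSp`-valued regular-Greenberg-ordinary
representation unramified outside `S ∪ {p}` is automorphic.  Implies the registered Stub 4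
(`weightTwoClassicalityRes_of_aut`); `≤` target.  OPEN IN PRINT at an endoscopic `𝔪`. -/
def WeightTwoClassicalityAut : Prop :=
  ∀ (p : ℕ) [Fact p.Prime], p ≠ 2 → ∀ (k : Type) [Field k] [CharP k p] [IsAlgClosed k]
    [TopologicalSpace k] [DiscreteTopology k] (red : Valued.integer (PadicAlgCl p) →+* k)
    (σ σ' : FramedGaloisRep ℚ k 2) (hcpt : isCompact_glFiniteIntegralLevel 4 ℚ) (ι : PadicAlgCl p ≃+* ℂ)
    (S : Finset (HeightOneSpectrum (𝓞 ℚ))) (ρ : FramedGaloisRep ℚ (PadicAlgCl p) 4),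
    σ.IsOdd → σ'.IsOdd → σ.toGaloisRep.IsIrreducible → σ'.toGaloisRep.IsIrreducible → DetC p k σ σ' →
    (¬ ∃ g : GL (Fin 2) k, ∀ x, g * σ x * g⁻¹ = σ' x) →
    ρ.toGaloisRep.IsIrreducible → Sh p k red σ σ' ρ → ProAutStrict p hcpt ι S ρ → Aut p hcpt ι ρ

/-! ## Endo-removal, packaged -/

section EndoRemoval

variable {p : ℕ} [Fact p.Prime]

/-- **Endo-removal for `ProAut`** (the stub-worker's `stub_endoRemoval`, specialised to line B's `Aut`/`OrdLevel`):
on an admissible fibre (`σ̄, σ̄'` irreducible, non-conjugate) an irreducible `ρ` with the a.e. residual factorisation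
and `ProAut S ρ` has `ProAutStrict S ρ`. -/
theorem proAutStrict_of_proAut {k : Type} [Field k] [CharP k p] [IsAlgClosed k] [TopologicalSpace k]
    [DiscreteTopology k] {red : Valued.integer (PadicAlgCl p) →+* k} {σ σ' : FramedGaloisRep ℚ k 2}
    {hcpt : isCompact_glFiniteIntegralLevel 4 ℚ} {ι : PadicAlgCl p ≃+* ℂ}
    {S : Finset (HeightOneSpectrum (𝓞 ℚ))} {ρ : FramedGaloisRep ℚ (PadicAlgCl p) 4}
    (hσ : σ.toGaloisRep.IsIrreducible) (hσ' : σ'.toGaloisRep.IsIrreducible)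
    (hnc : ¬ ∃ g : GL (Fin 2) k, ∀ x, g * σ x * g⁻¹ = σ' x) (hρ : ρ.toGaloisRep.IsIrreducible)
    (hae : ∀ᶠ v : HeightOneSpectrum (𝓞 ℚ) in Filter.cofinite,
      ρ.IsUnramifiedAt v ∧ σ.IsUnramifiedAt v ∧ σ'.IsUnramifiedAt v ∧
        ∃ (P : Polynomial (Valued.integer (PadicAlgCl p))) (P₁ P₂ : Polynomial k),
          ρ.HasFrobCharpolyAt v (P.map (Valued.integer (PadicAlgCl p)).subtype) ∧
            σ.HasFrobCharpolyAt v P₁ ∧ σ'.HasFrobCharpolyAt v P₂ ∧ P.map red = P₁ * P₂)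
    (h : ProAut p hcpt ι S ρ) : ProAutStrict p hcpt ι S ρ :=
  stub_endoRemoval p k red σ σ' (Aut p hcpt ι) (OrdLevel p S) ρ hσ hσ' hnc hρ hae h

/-- Trivially `ProAutStrict S ρ → ProAut S ρ`. -/
theorem proAut_of_proAutStrict {hcpt : isCompact_glFiniteIntegralLevel 4 ℚ} {ι : PadicAlgCl p ≃+* ℂ}
    {S : Finset (HeightOneSpectrum (𝓞 ℚ))} {ρ : FramedGaloisRep ℚ (PadicAlgCl p) 4}
    (h : ProAutStrict p hcpt ι S ρ) : ProAut p hcpt ι S ρ := fun n => by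
  obtain ⟨r', hA, hO, hb⟩ := h n
  exact ⟨r', Or.inl hA, hO, hb⟩

end EndoRemoval

/-! ## L1 with and without `Endo` are equivalent; L2 may assume automorphic approximants -/

/-- **`ProAutOfShStrict ↔ ProAutOfSh`**: the endoscopic alternative in L1 is free (endo-removal one way, weakening
the other). -/
theorem proAutOfShStrict_iff : ProAutOfShStrict ↔ ProAutOfSh := by
  constructor
  · intro h p _ hp k _ _ _ _ _ red σ σ' hcpt ι ρ hσ hσ' hdet hnc hρ hSh
    obtain ⟨S, hS⟩ := h p hp k red σ σ' hcpt ι ρ hσ hσ' hdet hnc hρ hSh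
    exact ⟨S, proAut_of_proAutStrict hS⟩
  · intro h p _ hp k _ _ _ _ _ red σ σ' hcpt ι ρ hσ hσ' hdet hnc hρ hSh
    obtain ⟨S, hS⟩ := h p hp k red σ σ' hcpt ι ρ hσ hσ' hdet hnc hρ hSh
    exact ⟨S, proAutStrict_of_proAut hσ hσ' hnc hρ hSh.2.2 hS⟩

/-- **`WeightTwoClassicalityAut → WeightTwoClassicalityRes`**: the registered Stub 4 follows from its form with
automorphic approximants (endo-removal inside). -/
theorem weightTwoClassicalityRes_of_aut (h : WeightTwoClassicalityAut) : WeightTwoClassicalityRes := by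
  intro p _ hp k _ _ _ _ _ red σ σ' hcpt ι S ρ _ _ _ _ hodd hodd' hσ hσ' hdet hnc hirr hsymp hord hae hpro
  exact h p hp k red σ σ' hcpt ι S ρ hodd hodd' hσ hσ' hdet hnc hirr ⟨hsymp, hord, hae⟩
    (proAutStrict_of_proAut hσ hσ' hnc hirr hae hpro)

/-- **target ⟹ `WeightTwoClassicalityAut`** (the limit hypothesis is discarded): no risk beyond conjunct (B). -/
theorem weightTwoClassicalityAut_of_phantomRMSector
    (h : Summit.Langlands.Langlands.Theses.PhantomRMYoshida.PhantomRMSector) : WeightTwoClassicalityAut := by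
  intro p _ hp k _ _ _ _ _ red σ σ' hcpt ι S ρ hodd hodd' hσ hσ' hdet hnc hirr hSh _
  exact h p hp k red σ σ' hcpt ι ρ hodd hodd' hσ hσ' hdet hnc hirr hSh

/-- **The glued split, strict form, gives the TARGET**: `ProAutOfSh → WeightTwoClassicalityAut → PhantomRMSector`. -/
theorem phantomRMSector_of_strict (h1 : ProAutOfSh) (h4 : WeightTwoClassicalityAut) :
    Summit.Langlands.Langlands.Theses.PhantomRMYoshida.PhantomRMSector := by
  intro p _ hp k _ _ _ _ _ red σ σ' hcpt ι ρ _ hodd hodd' hσ hσ' hdet hnc hirr hSh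
  obtain ⟨S, hS⟩ := h1 p hp k red σ σ' hcpt ι ρ hσ hσ' hdet hnc hirr hSh
  exact h4 p hp k red σ σ' hcpt ι S ρ hodd hodd' hσ hσ' hdet hnc hirr hSh
    (proAutStrict_of_proAut hσ hσ' hnc hirr hSh.2.2 hS)

/-- … and the crux: `ProAutOfSh → WeightTwoClassicalityAut → ResiduallyYoshidaLifting`. -/
theorem residuallyYoshidaLifting_of_strict (h1 : ProAutOfSh) (h4 : WeightTwoClassicalityAut) :
    Summit.Langlands.Langlands.Theses.PhantomRMYoshida.ResiduallyYoshidaLifting :=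
  residuallyYoshidaLifting_of_proAutOfSh h1 (weightTwoClassicalityRes_of_aut h4)

/-- **Registered sub-goal `stub_endoscopicResiduesStrict`**: L1 with/without `Endo` equivalent; Stub 4 from its
`Aut`-only form; target from (L1, L2-strict); L2-strict from the target. -/
theorem stub_endoscopicResiduesStrict :
    (ProAutOfShStrict ↔ ProAutOfSh) ∧
    (WeightTwoClassicalityAut → WeightTwoClassicalityRes) ∧
    (ProAutOfSh → WeightTwoClassicalityAut →
      Summit.Langlands.Langlands.Theses.PhantomRMYoshida.PhantomRMSector) ∧
    (Summit.Langlands.Langlands.Theses.PhantomRMYoshida.PhantomRMSector → WeightTwoClassicalityAut) :=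
  ⟨proAutOfShStrict_iff, weightTwoClassicalityRes_of_aut, phantomRMSector_of_strict,
    weightTwoClassicalityAut_of_phantomRMSector⟩

end Summit.Langlands.Langlands.Cruxes.ResiduallyYoshidaLifting.EndoscopicCrossingEuler

end
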